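import Summits.QuantumFields.YangMills.Theorems.UnitScaleTiltProp7CoarseFineKernelRows
import Summits.QuantumFields.YangMills.Theorems.UnitScaleTiltProp7H1fNormOfSupLetters
import HarnessLib

/-!
# Route `UnitScaleTilt`, crux K1 «MinimiserStabilityRegPr» (stmt-QuantumFields-19200), EX face — K137 STOREY, FILE (H-door):
# **THE DOOR FOR THE EX ROW `h133`** — the pointwise kernel of `H = GQ_k†(Q_kGQ_k†)⁻¹` (coarse block column → fine bond row; print's (3.133) «|H(b, y)| ≤ O(1)e^{−δ₁d}») from the
# SAME coarse entry letter `hKinv` of `K⁻¹` that feeds `hCk`∕`h137kπ`∕`h137kΔ` and ONE G-letter in px16's N4 §3 shape (block-supported sup → decayed pointwise bound), at the row's slot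

Cell `ym3-torus` (HUMAN RULING D-0037; rung R3 = SU(2) YM₃ on T³ — NOT d = 4, NOT infinite volume, NOT a mass gap, NOT Clay).  Width seat `ym3-torus-px10` (gen 13; FREE px after
✓p768275∕✓p768476∕✓p768615∕✓p768818); CLAIM 2026-08-30 10:25Z (first refusal ★p1 g27 ∕ px16 g13 ∕ cst-p1 g36 ∕ px12 g17).  THEOREMS ONLY (0 `def`, 0 `sorry`, default heartbeats);
`--supports stmt-QuantumFields-19200 --as helper`; count-neutral.

THE ROW (EX display S47 ✓`Prop7StubEXOfChartPiecesTwS47` ll.183–193; consumers ✓`Prop7ColumnRowsOfKernelDecay.hHcol_of_kernel133_family` → `hHcol` → `τ(T_J)` (★p1 g27 LOCATE №27) and the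
h88-DOOR (LOCATE №26)).  `h133` := `‖flat115 (H1f … a (DeltaPiSlotP … a) U₀ (δ_y ⊗ Z)) b′‖ ≤ CH·e^{−(δH∕2)·tdist(B((bondEquiv)⁻¹b′), ŷ)}·‖Z‖` — the (3.133) kernel row of `H_π`, NO
`η`-power (coarse column, fine row; ✓`Prop7Op137OfKernelRows` LETTER CHOICE).  DICTIONARY (cst-p1 g36 ✓`equiv_H1f_eq_cfgEquiv`, lit ✓`flat115_apply`, ✓`cfgEquiv_apply`):
`flat115 (H1f … Y) b′ = toL2⁻¹(HT …(toL2B Y))((bondEquiv)⁻¹ b′)`; and ON THE CLASS `HT = GT ∘ Q_k† ∘ KinvT` (✓`HT_eq_comp`).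
THE DISPLAYED LETTERS (both at rate `δ`; the row's slot `Δx` generic).
  `hKinv : ∀ y Z y′, ‖toL2B⁻¹(KinvT … a Δx U₀ (toL2B(δ_y Z)))(y′)‖ ≤ C_K·e^{−δ·tdist(ŷ′, ŷ)}·‖Z‖` — ✓p768818 `kinvRow_of_coercive_of_conjResolvent`'s output ∕ the `hCk` door's letter VERBATIM;
  `hGblk : ∀ X z, (∀ b, X b ≠ 0 → B b₋ = z) → ∀ s, 0 ≤ s → (∀ b, ‖X b‖ ≤ s) → ∀ bd, ‖toL2⁻¹(GT … a Δx U₀ (toL2 X)) bd‖ ≤ s·C_G·e^{−δ·tdist(B bd₋, z)}` — px16 g13's N4 §3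
  ✓`Prop7OneFormGreenSupBound.norm_symm_GT_apply_le_of_blockSupport` SHAPE (there at `Δx := DeltaEtaSlot`, `C_G := A₂`, `δ := min r (1∕4)∕2`, under its letters; at the Π-slot = N6's output).
THE ARGUMENT.  §1 ★`kernelRow_CF_of_blockSup_comp_CF` — the SIBLING composition for a block-sup letter: `B(T v)` with `W := toL2⁻¹(T v)` split into its block pieces `W_z := 1_{B = z}W`
(`Σ_z W_z = W`), each supported in `z` with sup `≤ C_T e^{−μ_T tdist(z, ŷ)}‖Z‖` by CF(T); `hGblk` on each piece, the rate bookkeeping ✓`exp_mul_exp_le_of_triangle`, and the coarse volume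
✓`sum_exp_neg_mul_tdist_coarse_le`: CF(B∘T; C_B·C_T·(2(1+1∕ν))³, r) for `0 ≤ r ≤ μ_T`, `r + ν ≤ μ_B`.  §2 ★★★`kernelH_of_kinvRow_of_greenBlockSup` — MEMBER: `Q_k† ∘ K⁻¹` by part 1's
✓`kernelRow_CF_comp_CC` with the tube row ✓`kernelRow_adjoint_Qk_of_regPr` at the free rate `δ+1` (rate `δ` kept, `× 10(cB∕c₀)ℓ⁻³e^{δ+1}·192`), then `G ∘ (Q_k†K⁻¹)` by §1 (`r = ν = δ∕2`, `× C_G·(2(1+2∕δ))³`)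
⟹ CF(HT; …, δ∕2) on the class.  §3 ★★★`kernel133_of_kinvRow_of_greenBlockSup` — the `h133` MEMBER TEXT (the `flat115 ∘ H1f ∘ (bondEquiv)⁻¹` dressing by the dictionary), rate `δ∕2` = S47's
`δH L∕2` convention with `δH := δ`; §4 ★★★`kernel133_family_of_kinvRow_of_greenBlockSup` — Idx EDITION in S47's `h133` text (slot `DeltaPiSlotP … (a L i)`, thread `Λ`, cap windows; family
scalings `CK L·((c₀∕cB)ℓ³)` and `CG L` L-only ⟹ `CH L := 1920·e^{δ L+1}·CK L·CG L·(2(1+2∕δ L))³`, NO `η`-power).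
HYP-SAT (★★OWNER №42).  `hKinv`, `hGblk`: displayed rows of record with named suppliers ((K2-KNIT) ✓p768818; N4∕N6), class (1); RegPr + windows + `PosOnto` inhabited on the literal
families; no conclusion-shaped letter (the conclusion is the kernel of a THREE-factor composite).  HONEST SCOPE.  Schur bookkeeping; no estimate of print is proved; nothing of
(3.132)∕(3.133)'s inputs, `G_π`'s letters (N6), the other EX rows, EX or the crux is proved here; the Yang–Mills mass gap is NOT proved.

References: T. Bałaban, CMP **99** (1985) 389–434 [Balaban1985BackgroundPropagators] ((3.126) p.420, (3.132)–(3.133) p.422, Thm 3.12 p.423, (3.46)–(3.49) pp.398–399);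
CMP **102** (1985) 277–309 [Balaban1985Variational] ((45)–(46) p.285, (103) p.293, (115) p.294); CMP **96** (1984) 223–250 [Balaban1984PropagatorsII] (§2, (2.61) p.234).
-/

set_option autoImplicit false

noncomputable section

open scoped BigOperators Matrix.Norms.L2Operator InnerProductSpace ComplexConjugate

namespace Summit.QuantumFields.YangMills.Theorems.Prop7Kernel133DoorOfKinvRow

open Literature.MathematicalPhysics.QuantumFieldTheory.Balaban1983to89
open Literature.MathematicalPhysics.QuantumFieldTheory.Balaban1983to89.T3ContinuumYM3Torus
open Literature.MathematicalPhysics.QuantumFieldTheory.Balaban1983to89.T3Thm1Carrier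
open T3PrintedRegularMinimiser (RegPr)
open T3PrintedMinimiserExistence (regPr_mono)
open T3PrintedRegularOrbits (sites_eq)
open T3LevelShift (siteShift)
open B9SectCLatticeCarrier (Bond)
open B9Eq311L2Pairing (WL2)
open B11Eq103H1Complex (BondL2K)
open B11Eq90V0primeCurrent (flat115 flat115_apply)
open B5Eq118OneStroke (iterBlockOf)
open Summit.QuantumFields.YangMills.Theorems.Prop7SectET3Transport (periodsT3 bondEquiv cfgEquiv cfgEquiv_apply)
open Summit.QuantumFields.YangMills.Theorems.Prop7SectET3HilbertLetters (W₂ toL2 toL2B)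
open Summit.QuantumFields.YangMills.Theorems.Prop7SectET3CurvedPropagators (Qk GT KinvT HT H1f PosOnto HT_eq_comp)
open Summit.QuantumFields.YangMills.Theorems.Prop7SectET3DeltaPiPInv (DeltaPiSlotP)
open Summit.QuantumFields.YangMills.Theorems.Prop7BlockDistanceWeights (sum_exp_neg_mul_tdist_coarse_le tdist_coarse_comm tdist_coarse_triangle)
open Summit.QuantumFields.YangMills.Theorems.Prop7CoarseFineKernelRows (exp_mul_exp_le_of_triangle kernelRow_CF_comp_CC kernelRow_adjoint_Qk_of_regPr)
open Summit.QuantumFields.YangMills.Theorems.Prop7H1fNormOfSupLetters (equiv_H1f_eq_cfgEquiv)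

/-! ## §1 ★ The sibling composition: a block-sup letter after a coarse→fine row -/

section BlockSup

variable (F : T3Family) {n K : ℕ} (h : n ≤ K) (c₀ cB : ℝ)

/-- ★ **CF(B ∘ T) FROM A BLOCK-SUPPORTED SUP LETTER OF `B` AND CF(T)**: if `T` (coarse → fine) has the row `C_T·e^{−μ_T·tdist(B b, ŷ)}` and `B` (fine → fine) maps every field supported in the
block `z` with sup `≤ s` to a field with `‖·(bd)‖ ≤ s·C_B·e^{−μ_B·tdist(B bd, z)}`, then for `0 ≤ r ≤ μ_T`, `0 < ν`, `r + ν ≤ μ_B`: `B ∘ T` has the row `C_B·C_T·(2(1+1∕ν))³·e^{−r·tdist(B bd, ŷ)}`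
— split the middle field into block pieces. [cite: Balaban1985BackgroundPropagators, (3.47)–(3.49) pp.398–399, (3.133) p.422; Balaban1984PropagatorsII, (2.61) p.234] -/
theorem kernelRow_CF_of_blockSup_comp_CF (B : BondL2K ℂ 3 (periodsT3 F K) c₀ W₂ →ₗ[ℂ] BondL2K ℂ 3 (periodsT3 F K) c₀ W₂)
    (T : WL2 ℂ (fun _ : PBond (F.P n) 0 => cB) W₂ →ₗ[ℂ] BondL2K ℂ 3 (periodsT3 F K) c₀ W₂)
    {CB CT μB μT r ν : ℝ} (hCB : 0 ≤ CB) (hCT : 0 ≤ CT) (hr : 0 ≤ r) (hrT : r ≤ μT) (hν : 0 < ν) (hrB : r + ν ≤ μB)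
    (hB : ∀ (X : PBond (F.P K) 0 → Matrix (Fin 2) (Fin 2) ℂ) (z : Site (F.P K) (K - n)), (∀ b, X b ≠ 0 → iterBlockOf (K - n) b.src = z) →
      ∀ s : ℝ, 0 ≤ s → (∀ b, ‖X b‖ ≤ s) →
        ∀ bd : PBond (F.P K) 0, ‖(toL2 F K c₀).symm (B (toL2 F K c₀ X)) bd‖ ≤ s * CB * Real.exp (-(μB * (Site.tdist (P := F.P K) (iterBlockOf (K - n) bd.src) z : ℝ))))
    (hT : ∀ (y : PBond (F.P n) 0) (Z : Matrix (Fin 2) (Fin 2) ℂ) (b : PBond (F.P K) 0),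
      ‖(toL2 F K c₀).symm (T (toL2B F n cB (Pi.single y Z))) b‖
        ≤ CT * Real.exp (-(μT * (Site.tdist (P := F.P K) (iterBlockOf (K - n) b.src) (siteShift (sites_eq F n K h) y.src) : ℝ))) * ‖Z‖)
    (y : PBond (F.P n) 0) (Z : Matrix (Fin 2) (Fin 2) ℂ) (bd : PBond (F.P K) 0) :
    ‖(toL2 F K c₀).symm ((B ∘ₗ T) (toL2B F n cB (Pi.single y Z))) bd‖
      ≤ CB * CT * (2 * (1 + 1 / ν)) ^ 3
          * Real.exp (-(r * (Site.tdist (P := F.P K) (iterBlockOf (K - n) bd.src) (siteShift (sites_eq F n K h) y.src) : ℝ))) * ‖Z‖ := by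
  classical
  -- the middle field and its block pieces
  set W : PBond (F.P K) 0 → Matrix (Fin 2) (Fin 2) ℂ := (toL2 F K c₀).symm (T (toL2B F n cB (Pi.single y Z))) with hW
  have hTW : T (toL2B F n cB (Pi.single y Z)) = toL2 F K c₀ W := by rw [hW, LinearEquiv.apply_symm_apply]
  let Wz : Site (F.P K) (K - n) → PBond (F.P K) 0 → Matrix (Fin 2) (Fin 2) ℂ := fun z b => if iterBlockOf (K - n) b.src = z then W b else 0
  have hsumW : ∑ z : Site (F.P K) (K - n), Wz z = W := by
    funext b
    rw [Finset.sum_apply]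
    exact Finset.sum_ite_eq _ _ _ |>.trans (if_pos (Finset.mem_univ _))
  have hsplit : (toL2 F K c₀).symm (B (toL2 F K c₀ W)) bd = ∑ z : Site (F.P K) (K - n), (toL2 F K c₀).symm (B (toL2 F K c₀ (Wz z))) bd := by
    conv_lhs => rw [← hsumW]
    rw [map_sum, map_sum, map_sum, Finset.sum_apply]
  -- each piece: supported in `z`, sup `≤ C_T e^{−μ_T tdist(z, ŷ)}‖Z‖`
  set ŷ : Site (F.P K) (K - n) := siteShift (sites_eq F n K h) y.src with hŷ
  have hsupp : ∀ z b, Wz z b ≠ 0 → iterBlockOf (K - n) b.src = z := fun z b hb => by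
    by_contra hne
    exact hb (if_neg hne)
  have hsup : ∀ z b, ‖Wz z b‖ ≤ CT * Real.exp (-(μT * (Site.tdist (P := F.P K) z ŷ : ℝ))) * ‖Z‖ := fun z b => by
    by_cases hb : iterBlockOf (K - n) b.src = z
    · have := hT y Z b
      rw [hb] at this
      change ‖if iterBlockOf (K - n) b.src = z then W b else 0‖ ≤ _
      rw [if_pos hb]; exact this
    · change ‖if iterBlockOf (K - n) b.src = z then W b else 0‖ ≤ _
      rw [if_neg hb, norm_zero]; positivity
  have hpiece : ∀ z, ‖(toL2 F K c₀).symm (B (toL2 F K c₀ (Wz z))) bd‖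
      ≤ CB * CT * ‖Z‖ * Real.exp (-(r * (Site.tdist (P := F.P K) (iterBlockOf (K - n) bd.src) ŷ : ℝ))) * Real.exp (-(ν * (Site.tdist (P := F.P K) (iterBlockOf (K - n) bd.src) z : ℝ))) := by
    intro z
    have h1 := hB (Wz z) z (hsupp z) _ (by positivity) (hsup z) bd
    have h3 := exp_mul_exp_le_of_triangle (νA := 0) (μA := μT) (μB := μB) (νB := ν) (Nat.cast_nonneg (Site.tdist (P := F.P K) (iterBlockOf (K - n) bd.src) z))
      (Nat.cast_nonneg (Site.tdist (P := F.P K) z ŷ)) (tdist_coarse_triangle F (iterBlockOf (K - n) bd.src) z ŷ) hr (by linarith) hrB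
    rw [zero_mul, neg_zero, Real.exp_zero, mul_one] at h3
    calc ‖(toL2 F K c₀).symm (B (toL2 F K c₀ (Wz z))) bd‖
        ≤ CT * Real.exp (-(μT * (Site.tdist (P := F.P K) z ŷ : ℝ))) * ‖Z‖ * CB * Real.exp (-(μB * (Site.tdist (P := F.P K) (iterBlockOf (K - n) bd.src) z : ℝ))) := h1
      _ = CB * CT * ‖Z‖ * (Real.exp (-(μB * (Site.tdist (P := F.P K) (iterBlockOf (K - n) bd.src) z : ℝ))) * Real.exp (-(μT * (Site.tdist (P := F.P K) z ŷ : ℝ)))) := by ring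
      _ ≤ CB * CT * ‖Z‖ * (Real.exp (-(r * (Site.tdist (P := F.P K) (iterBlockOf (K - n) bd.src) ŷ : ℝ))) * Real.exp (-(ν * (Site.tdist (P := F.P K) (iterBlockOf (K - n) bd.src) z : ℝ)))) :=
          mul_le_mul_of_nonneg_left h3 (by positivity)
      _ = _ := by ring
  rw [LinearMap.comp_apply, hTW, hsplit]
  refine (norm_sum_le _ _).trans ((Finset.sum_le_sum fun z _ => hpiece z).trans ?_)
  rw [← Finset.mul_sum]
  have hvol : ∑ z : Site (F.P K) (K - n), Real.exp (-(ν * (Site.tdist (P := F.P K) (iterBlockOf (K - n) bd.src) z : ℝ))) ≤ (2 * (1 + 1 / ν)) ^ 3 := by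
    have hs := sum_exp_neg_mul_tdist_coarse_le F (n := n) (K := K) hν (iterBlockOf (K - n) bd.src)
    exact le_trans (le_of_eq (Finset.sum_congr rfl fun z _ => by rw [tdist_coarse_comm])) hs
  have hc : 0 ≤ CB * CT * ‖Z‖ * Real.exp (-(r * (Site.tdist (P := F.P K) (iterBlockOf (K - n) bd.src) ŷ : ℝ))) := by positivity
  calc CB * CT * ‖Z‖ * Real.exp (-(r * (Site.tdist (P := F.P K) (iterBlockOf (K - n) bd.src) ŷ : ℝ))) * ∑ z : Site (F.P K) (K - n), Real.exp (-(ν * (Site.tdist (P := F.P K) (iterBlockOf (K - n) bd.src) z : ℝ)))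
      ≤ CB * CT * ‖Z‖ * Real.exp (-(r * (Site.tdist (P := F.P K) (iterBlockOf (K - n) bd.src) ŷ : ℝ))) * (2 * (1 + 1 / ν)) ^ 3 := mul_le_mul_of_nonneg_left hvol hc
    _ = _ := by ring

end BlockSup

/-! ## §2 ★★★ The kernel of `H = GQ_k†K⁻¹` on the class, member -/

section Member

variable (F : T3Family) {n K : ℕ} (h : n ≤ K) (c₀ cB : ℝ) [Fact (0 < c₀)] [Fact (0 < cB)]

/-- ★★★ **THE KERNEL OF `H = G ∘ Q_k† ∘ K⁻¹` (coarse → fine), MEMBER, GENERIC SLOT**: at a printed-regular background (`RegPr F n K ε₀ U₀`, windows `10¹⁰L⁶ε₀ ≤ 1`, `10¹²L³ε₀ ≤ 1`) on the class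
`PosOnto … a Δx U₀`, `hKinv` (C_K, δ) and `hGblk` (C_G, δ) give `‖toL2⁻¹(HT …(toL2B(δ_y ⊗ Z)))(bd)‖ ≤ ((2·5·(cB∕c₀)ℓ⁻³e^{δ+1})·C_K·(3·(2·2)³))·C_G·(2(1+2∕δ))³·e^{−(δ∕2)·tdist(B bd, ŷ)}·‖Z‖`.
[cite: Balaban1985BackgroundPropagators, (3.126) p.420, (3.132)–(3.133) p.422, Thm 3.12 p.423; Balaban1985Variational, (45)–(46) p.285] -/
theorem kernelH_of_kinvRow_of_greenBlockSup {ε₀ : ℝ} (hε₀ : 0 < ε₀) (hε : 10 ^ 10 * (F.L : ℝ) ^ 6 * ε₀ ≤ 1) (hε12 : 10 ^ 12 * (F.L : ℝ) ^ 3 * ε₀ ≤ 1)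
    (U₀ : GaugeField (F.P K) 0 (Matrix.specialUnitaryGroup (Fin 2) ℂ)) (hreg : RegPr F n K ε₀ U₀) (a : ℝ)
    (Δx : GaugeField (F.P K) 0 (Matrix.specialUnitaryGroup (Fin 2) ℂ) → (BondL2K ℂ 3 (periodsT3 F K) c₀ W₂ →ₗ[ℂ] BondL2K ℂ 3 (periodsT3 F K) c₀ W₂))
    (hp : PosOnto F n K h c₀ cB a Δx U₀) {CK CG δ : ℝ} (hCK : 0 ≤ CK) (hCG : 0 ≤ CG) (hδ : 0 < δ)
    (hKinv : ∀ (y : PBond (F.P n) 0) (Z : Matrix (Fin 2) (Fin 2) ℂ) (y' : PBond (F.P n) 0),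
      ‖(toL2B F n cB).symm (KinvT F n K h c₀ cB a Δx U₀ (toL2B F n cB (Pi.single y Z))) y'‖
        ≤ CK * Real.exp (-(δ * (Site.tdist (P := F.P K) (siteShift (sites_eq F n K h) y'.src) (siteShift (sites_eq F n K h) y.src) : ℝ))) * ‖Z‖)
    (hGblk : ∀ (X : PBond (F.P K) 0 → Matrix (Fin 2) (Fin 2) ℂ) (z : Site (F.P K) (K - n)), (∀ b, X b ≠ 0 → iterBlockOf (K - n) b.src = z) →
      ∀ s : ℝ, 0 ≤ s → (∀ b, ‖X b‖ ≤ s) →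
        ∀ bd : PBond (F.P K) 0, ‖(toL2 F K c₀).symm (GT F n K h c₀ cB a Δx U₀ (toL2 F K c₀ X)) bd‖ ≤ s * CG * Real.exp (-(δ * (Site.tdist (P := F.P K) (iterBlockOf (K - n) bd.src) z : ℝ))))
    (y : PBond (F.P n) 0) (Z : Matrix (Fin 2) (Fin 2) ℂ) (bd : PBond (F.P K) 0) :
    ‖(toL2 F K c₀).symm (HT F n K h c₀ cB a Δx U₀ (toL2B F n cB (Pi.single y Z))) bd‖
      ≤ CG * ((2 * 5 * (cB / c₀) * ((F.L : ℝ) ^ (K - n))⁻¹ ^ 3 * Real.exp (δ + 1)) * CK * (3 * (2 * (1 + 1 / 1)) ^ 3)) * (2 * (1 + 1 / (δ / 2))) ^ 3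
          * Real.exp (-(δ / 2 * (Site.tdist (P := F.P K) (iterBlockOf (K - n) bd.src) (siteShift (sites_eq F n K h) y.src) : ℝ))) * ‖Z‖ := by
  have hc₀ : 0 < c₀ := Fact.out
  have hcB : 0 < cB := Fact.out
  have hL0 : (0 : ℝ) < F.L := by exact_mod_cast lt_trans zero_lt_one F.hL.2
  have hδ1 : 0 ≤ δ + 1 := by linarith
  have hδh : 0 < δ / 2 := by linarith
  -- (1) `Q_k† ∘ K⁻¹` : coarse → fine, rate `δ` kept
  have hT := kernelRow_CF_comp_CC F h c₀ cB (LinearMap.adjoint (Qk F n K h c₀ cB U₀)) (KinvT F n K h c₀ cB a Δx U₀) (r := δ) (ν := 1)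
    (by positivity) hCK hδ.le le_rfl one_pos (by linarith) (kernelRow_adjoint_Qk_of_regPr F h c₀ cB hε₀ hε hε12 U₀ hreg hδ1) hKinv
  -- (2) `G ∘ (Q_k†K⁻¹)` : coarse → fine, rate `δ∕2`
  have hH := kernelRow_CF_of_blockSup_comp_CF F h c₀ cB (GT F n K h c₀ cB a Δx U₀) (LinearMap.adjoint (Qk F n K h c₀ cB U₀) ∘ₗ KinvT F n K h c₀ cB a Δx U₀)
    (r := δ / 2) (ν := δ / 2) hCG (by positivity) hδh.le (by linarith) hδh (by linarith) hGblk hT y Z bd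
  rw [HT_eq_comp hp]
  exact hH

end Member

/-! ## §3 ★★★ The `h133` member text: the `flat115 ∘ H1f` dressing -/

section Dressing

variable (F : T3Family) {n K : ℕ} (h : n ≤ K) (c₀ cB : ℝ) [Fact (0 < c₀)] [Fact (0 < cB)] [Fact (0 < (F.L : ℝ))] [Fact (0 < ((F.L : ℝ)⁻¹) ^ (K - n))]

/-- **THE DICTIONARY**: `flat115 (H1f … U₀ Y) b′ = toL2⁻¹(HT …(toL2B Y))((bondEquiv)⁻¹ b′)` (cst-p1 g36 ✓`equiv_H1f_eq_cfgEquiv`, lit ✓`flat115_apply`, ✓`cfgEquiv_apply`).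
[cite: Balaban1985Variational, (103) p.293, (115) p.294] -/
theorem flat115_H1f_apply (a : ℝ) (Δx : GaugeField (F.P K) 0 (Matrix.specialUnitaryGroup (Fin 2) ℂ) → (BondL2K ℂ 3 (periodsT3 F K) c₀ W₂ →ₗ[ℂ] BondL2K ℂ 3 (periodsT3 F K) c₀ W₂))
    (U₀ : GaugeField (F.P K) 0 (Matrix.specialUnitaryGroup (Fin 2) ℂ)) (Y : PBond (F.P n) 0 → Matrix (Fin 2) (Fin 2) ℂ) (b' : Bond 3 (periodsT3 F K)) :
    flat115 (H1f F n K h c₀ cB a Δx U₀ Y) b' = (toL2 F K c₀).symm (HT F n K h c₀ cB a Δx U₀ (toL2B F n cB Y)) ((bondEquiv F K).symm b') := by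
  rw [flat115_apply, equiv_H1f_eq_cfgEquiv, cfgEquiv_apply]

/-- ★★★ **DOOR «KERNEL-133», MEMBER, GENERIC SLOT**: §2 in the `h133` dressing — `‖flat115 (H1f … U₀ (δ_y ⊗ Z)) b′‖ ≤ C·e^{−(δ∕2)·tdist(B((bondEquiv)⁻¹b′), ŷ)}·‖Z‖` with §2's constant.
[cite: Balaban1985BackgroundPropagators, (3.133) p.422, Thm 3.12 p.423, (3.126) p.420; Balaban1985Variational, (45)–(46) p.285, (103) p.293] -/
theorem kernel133_of_kinvRow_of_greenBlockSup {ε₀ : ℝ} (hε₀ : 0 < ε₀) (hε : 10 ^ 10 * (F.L : ℝ) ^ 6 * ε₀ ≤ 1) (hε12 : 10 ^ 12 * (F.L : ℝ) ^ 3 * ε₀ ≤ 1)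
    (U₀ : GaugeField (F.P K) 0 (Matrix.specialUnitaryGroup (Fin 2) ℂ)) (hreg : RegPr F n K ε₀ U₀) (a : ℝ)
    (Δx : GaugeField (F.P K) 0 (Matrix.specialUnitaryGroup (Fin 2) ℂ) → (BondL2K ℂ 3 (periodsT3 F K) c₀ W₂ →ₗ[ℂ] BondL2K ℂ 3 (periodsT3 F K) c₀ W₂))
    (hp : PosOnto F n K h c₀ cB a Δx U₀) {CK CG δ : ℝ} (hCK : 0 ≤ CK) (hCG : 0 ≤ CG) (hδ : 0 < δ)
    (hKinv : ∀ (y : PBond (F.P n) 0) (Z : Matrix (Fin 2) (Fin 2) ℂ) (y' : PBond (F.P n) 0),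
      ‖(toL2B F n cB).symm (KinvT F n K h c₀ cB a Δx U₀ (toL2B F n cB (Pi.single y Z))) y'‖
        ≤ CK * Real.exp (-(δ * (Site.tdist (P := F.P K) (siteShift (sites_eq F n K h) y'.src) (siteShift (sites_eq F n K h) y.src) : ℝ))) * ‖Z‖)
    (hGblk : ∀ (X : PBond (F.P K) 0 → Matrix (Fin 2) (Fin 2) ℂ) (z : Site (F.P K) (K - n)), (∀ b, X b ≠ 0 → iterBlockOf (K - n) b.src = z) →
      ∀ s : ℝ, 0 ≤ s → (∀ b, ‖X b‖ ≤ s) →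
        ∀ bd : PBond (F.P K) 0, ‖(toL2 F K c₀).symm (GT F n K h c₀ cB a Δx U₀ (toL2 F K c₀ X)) bd‖ ≤ s * CG * Real.exp (-(δ * (Site.tdist (P := F.P K) (iterBlockOf (K - n) bd.src) z : ℝ))))
    (y : PBond (F.P n) 0) (Z : Matrix (Fin 2) (Fin 2) ℂ) (b' : Bond 3 (periodsT3 F K)) :
    ‖flat115 (H1f F n K h c₀ cB a Δx U₀ (Pi.single y Z)) b'‖
      ≤ CG * ((2 * 5 * (cB / c₀) * ((F.L : ℝ) ^ (K - n))⁻¹ ^ 3 * Real.exp (δ + 1)) * CK * (3 * (2 * (1 + 1 / 1)) ^ 3)) * (2 * (1 + 1 / (δ / 2))) ^ 3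
          * Real.exp (-(δ / 2 * (Site.tdist (P := F.P K) (iterBlockOf (K - n) ((bondEquiv F K).symm b').src) (siteShift (sites_eq F n K h) y.src) : ℝ))) * ‖Z‖ := by
  rw [flat115_H1f_apply]
  exact kernelH_of_kinvRow_of_greenBlockSup F h c₀ cB hε₀ hε hε12 U₀ hreg a Δx hp hCK hCG hδ hKinv hGblk y Z _

end Dressing

/-! ## §4 ★★★ The Idx edition in the EX display's `h133` text -/

section Family

/-- ★★★ **DOOR «KERNEL-133», Idx EDITION AT THE Π-SLOT**: for a cap `α` with the windows of record, L-only weights, a member coupling `a L i`, ANY thread `Λ L i U₀` (S47: Lift), the class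
`PosOnto … (a L i) (DeltaPiSlotP … (a L i)) U₀` displayed under the thread, and the two family letters at a common rate `δ L` — `hKinv` at the Π-slot with constant `CK L·((c₀ L∕cB L)·ℓ³)` and
`hGblk` at the Π-slot with an L-ONLY `CG L` — the S47 ROW TEXT of `h133` holds under the same thread with `CH L := 1920·exp(δ L + 1)·CK L·CG L·(2(1+2∕δ L))³` (NO `η`-power) and `δH := δ`.
[cite: Balaban1985BackgroundPropagators, (3.133) p.422, Thm 3.12 p.423, (3.126) p.420; Balaban1985Variational, (45)–(46) p.285, (103) p.293] -/
theorem kernel133_family_of_kinvRow_of_greenBlockSup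
    [hFL : ∀ F : T3Family, Fact (0 < (F.L : ℝ))] [hFη : ∀ (F : T3Family) (k : ℕ), Fact (0 < ((F.L : ℝ)⁻¹) ^ k)]
    (α : ℕ → ℝ) (hα : ∀ L : ℕ, 1 < L → 0 < α L) (hW : ∀ L : ℕ, 1 < L → 10 ^ 10 * (L : ℝ) ^ 6 * α L ≤ 1) (hW' : ∀ L : ℕ, 1 < L → 10 ^ 12 * (L : ℝ) ^ 3 * α L ≤ 1)
    (c₀ cB : ℕ → ℝ) [hc₀ : ∀ L : ℕ, Fact (0 < c₀ L)] [hcB : ∀ L : ℕ, Fact (0 < cB L)] (a : ∀ L : ℕ, Idx L → ℝ)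
    (Λ : ∀ (L : ℕ) (i : Idx L), GaugeField (i.1.1.P i.1.2.2) 0 (Matrix.specialUnitaryGroup (Fin 2) ℂ) → Prop)
    (hpos : ∀ (L : ℕ), 1 < L → ∀ (i : Idx L) (U₀ : GaugeField (i.1.1.P i.1.2.2) 0 (Matrix.specialUnitaryGroup (Fin 2) ℂ)), ∀ ρ : ℝ, RegPr i.1.1 i.1.2.1 i.1.2.2 ρ U₀ → ρ ≤ α L →
      Λ L i U₀ → PosOnto i.1.1 i.1.2.1 i.1.2.2 i.2.2.le (c₀ L) (cB L) (a L i) (DeltaPiSlotP i.1.1 i.1.2.1 i.1.2.2 i.2.2.le (c₀ L) (cB L) (a L i)) U₀)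
    (CK CG δ : ℕ → ℝ) (hCK : ∀ L, 1 < L → 0 ≤ CK L) (hCG : ∀ L, 1 < L → 0 ≤ CG L) (hδ : ∀ L, 1 < L → 0 < δ L)
    (hKinv : ∀ (L : ℕ), 1 < L → ∀ (i : Idx L) (U₀ : GaugeField (i.1.1.P i.1.2.2) 0 (Matrix.specialUnitaryGroup (Fin 2) ℂ)), ∀ ρ : ℝ, RegPr i.1.1 i.1.2.1 i.1.2.2 ρ U₀ → ρ ≤ α L →
      Λ L i U₀ → ∀ (y : PBond (i.1.1.P i.1.2.1) 0) (Z : Matrix (Fin 2) (Fin 2) ℂ) (y' : PBond (i.1.1.P i.1.2.1) 0),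
        ‖(toL2B i.1.1 i.1.2.1 (cB L)).symm (KinvT i.1.1 i.1.2.1 i.1.2.2 i.2.2.le (c₀ L) (cB L) (a L i) (DeltaPiSlotP i.1.1 i.1.2.1 i.1.2.2 i.2.2.le (c₀ L) (cB L) (a L i)) U₀
            (toL2B i.1.1 i.1.2.1 (cB L) (Pi.single y Z))) y'‖
          ≤ CK L * ((c₀ L / cB L) * ((L : ℝ) ^ (i.1.2.2 - i.1.2.1)) ^ 3)
              * Real.exp (-(δ L * (Site.tdist (siteShift (sites_eq i.1.1 i.1.2.1 i.1.2.2 i.2.2.le) y'.src) (siteShift (sites_eq i.1.1 i.1.2.1 i.1.2.2 i.2.2.le) y.src) : ℝ))) * ‖Z‖)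
    (hGblk : ∀ (L : ℕ), 1 < L → ∀ (i : Idx L) (U₀ : GaugeField (i.1.1.P i.1.2.2) 0 (Matrix.specialUnitaryGroup (Fin 2) ℂ)), ∀ ρ : ℝ, RegPr i.1.1 i.1.2.1 i.1.2.2 ρ U₀ → ρ ≤ α L →
      Λ L i U₀ → ∀ (X : PBond (i.1.1.P i.1.2.2) 0 → Matrix (Fin 2) (Fin 2) ℂ) (z : Site (i.1.1.P i.1.2.2) (i.1.2.2 - i.1.2.1)),
        (∀ b, X b ≠ 0 → iterBlockOf (i.1.2.2 - i.1.2.1) b.src = z) → ∀ s : ℝ, 0 ≤ s → (∀ b, ‖X b‖ ≤ s) →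
          ∀ bd : PBond (i.1.1.P i.1.2.2) 0, ‖(toL2 i.1.1 i.1.2.2 (c₀ L)).symm (GT i.1.1 i.1.2.1 i.1.2.2 i.2.2.le (c₀ L) (cB L) (a L i)
              (DeltaPiSlotP i.1.1 i.1.2.1 i.1.2.2 i.2.2.le (c₀ L) (cB L) (a L i)) U₀ (toL2 i.1.1 i.1.2.2 (c₀ L) X)) bd‖
            ≤ s * CG L * Real.exp (-(δ L * (Site.tdist (iterBlockOf (i.1.2.2 - i.1.2.1) bd.src) z : ℝ)))) :
    ∀ (L : ℕ), 1 < L → ∀ (i : Idx L) (U₀ : GaugeField (i.1.1.P i.1.2.2) 0 (Matrix.specialUnitaryGroup (Fin 2) ℂ)), ∀ ρ : ℝ, RegPr i.1.1 i.1.2.1 i.1.2.2 ρ U₀ → ρ ≤ α L →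
      Λ L i U₀ → ∀ (y : PBond (i.1.1.P i.1.2.1) 0) (Z : Matrix (Fin 2) (Fin 2) ℂ) (b' : Bond 3 (periodsT3 i.1.1 i.1.2.2)),
        ‖flat115 ((H1f i.1.1 i.1.2.1 i.1.2.2 i.2.2.le (c₀ L) (cB L) (a L i) (DeltaPiSlotP i.1.1 i.1.2.1 i.1.2.2 i.2.2.le (c₀ L) (cB L) (a L i)) U₀) (Pi.single y Z)) b'‖
          ≤ (1920 * Real.exp (δ L + 1) * CK L * CG L * (2 * (1 + 2 / δ L)) ^ 3)
              * Real.exp (-(δ L / 2 * (Site.tdist (B5Eq118OneStroke.iterBlockOf (i.1.2.2 - i.1.2.1) ((bondEquiv i.1.1 i.1.2.2).symm b').src)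
                  (T3LevelShift.siteShift (T3PrintedRegularOrbits.sites_eq i.1.1 i.1.2.1 i.1.2.2 i.2.2.le) y.src) : ℝ))) * ‖Z‖ := by
  intro L hL i U₀ ρ hreg hρ hl y Z b'
  have hFL' : (i.1.1.L : ℝ) = (L : ℝ) := by rw [i.2.1]
  have hc₀L : 0 < c₀ L := (hc₀ L).out
  have hcBL : 0 < cB L := (hcB L).out
  have hL0 : (0 : ℝ) < (L : ℝ) := by exact_mod_cast lt_trans zero_lt_one hL
  have hℓ : (0 : ℝ) < (L : ℝ) ^ (i.1.2.2 - i.1.2.1) := pow_pos hL0 _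
  have hδL := hδ L hL
  have hregα : RegPr i.1.1 i.1.2.1 i.1.2.2 (α L) U₀ := regPr_mono (F := i.1.1) hρ hreg
  have hεw : 10 ^ 10 * (i.1.1.L : ℝ) ^ 6 * α L ≤ 1 := by rw [hFL']; exact hW L hL
  have hεw' : 10 ^ 12 * (i.1.1.L : ℝ) ^ 3 * α L ≤ 1 := by rw [hFL']; exact hW' L hL
  have hCKm : 0 ≤ CK L * ((c₀ L / cB L) * ((L : ℝ) ^ (i.1.2.2 - i.1.2.1)) ^ 3) := mul_nonneg (hCK L hL) (by positivity)
  haveI : Fact (0 < ((i.1.1.L : ℝ)⁻¹) ^ (i.1.2.2 - i.1.2.1)) := hFη i.1.1 _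
  have hmem := kernel133_of_kinvRow_of_greenBlockSup i.1.1 i.2.2.le (c₀ L) (cB L) (hα L hL) hεw hεw' U₀ hregα (a L i)
    (DeltaPiSlotP i.1.1 i.1.2.1 i.1.2.2 i.2.2.le (c₀ L) (cB L) (a L i)) (hpos L hL i U₀ ρ hreg hρ hl) hCKm (hCG L hL) hδL
    (hKinv L hL i U₀ ρ hreg hρ hl) (hGblk L hL i U₀ ρ hreg hρ hl) y Z b'
  refine hmem.trans (le_of_eq ?_)
  congr 1
  congr 1
  have h192 : (3 * (2 * (1 + 1 / 1 : ℝ)) ^ 3) = 192 := by norm_num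
  have h2 : (2 * (1 + 1 / (δ L / 2))) = (2 * (1 + 2 / δ L)) := by field_simp
  rw [hFL', h192, h2]
  field_simp
  ring

end Family

end Summit.QuantumFields.YangMills.Theorems.Prop7Kernel133DoorOfKinvRow

end
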